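import Literature.NumberTheory.Automorphic.SmoothedCuspForms
import Literature.NumberTheory.Automorphic.GLnAdelicLocallyCompact
import HarnessLib

/-!
# The block unipotent radicals `𝔫_k(𝔸_K)`: Haar measure, scaled and translated fundamental domains,
archimedean and finite parts
(Garrett, *Modern Analysis of Automorphic Forms by Example* (2018), §7.3, PDF pp. 335–340;
Tate, in Cassels–Fröhlich (1967), Ch. XV Thm. 4.1.3)

Structural bricks for the basic estimate for cusp forms on a Siegel set
(`GLnCuspidalSpectrum.norm_smoothedForm_le_of_isSiegelSetGL`, Garrett Thm. 7.3.10), concerning the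
additive group `V = 𝔫_k(𝔸_K)` of block-nilpotent adelic matrices (`blockNilpotent n k 𝔸_K` of
`GLnCuspidalSpectrum`), its lattice `𝔫_k(K)` (`rationalBlock`) and Tate's block fundamental domain
`𝓕₀` (`blockFundamentalDomain` of `AdelicFundamentalDomain`). Everything here is proved:

* `locallyCompactSpace_blockNilpotent`, `blockHaar n k K` — `V` is a closed subgroup of the locally
  compact `M_n(𝔸_K)`, hence carries an additive Haar measure (so the pairs `(ν, 𝓕)` of
  `ConstantTermVanishes` can be *chosen*).
* `blockScale a : V →+ V` — entrywise multiplication by an adele; `ratBlockScale` — the induced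
  bijections `γ ↦ c γ` of `𝔫_k(K)` for `c ∈ Kˣ`.
* `scaledBlockFundamentalDomain c = c · 𝓕₀` and its translates `v + c · 𝓕₀` (`c ∈ Kˣ`, `v ∈ V`):
  **measurable fundamental domains for `𝔫_k(K)` with respect to every measure**
  (`isAddFundamentalDomain_vadd_scaledBlockFundamentalDomain`; exact unique representability
  transported along `X ↦ c⁻¹ (X - v)`, Tate's Thm. 4.1.3 (1)), relatively compact, of positive
  finite Haar measure. Scaling by `c ∈ 𝔫 ∖ 0` makes the finite parts of the domain small
  (`snd_apply_of_mem_vadd_scaledBlockFundamentalDomain`: the finite entries of `X - v` are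
  `c`-multiples of integral finite adeles), which is how the finite places drop out of the kernel
  estimate (Garrett, PDF p. 340: "`ξ ∈ (1/h) 𝔫_𝔬` … a *lattice*").
* `blockArchPart`, `blockFinPart : V →+ V` — the decomposition `X = X_∞ + X_f` along
  `𝔸_K = K_∞ × 𝔸_K^∞`.

## References

* P. Garrett, *Modern Analysis of Automorphic Forms by Example* (2018), §7.3 (PDF pp. 335–340)
  [Garrett2018].
* J. Tate, *Fourier analysis in number fields and Hecke's zeta-functions*, in Cassels–Fröhlich,
  *Algebraic Number Theory* (1967), Ch. XV, Thm. 4.1.3 [CasselsFrohlichANT1967].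
-/

noncomputable section

open scoped MatrixGroups Pointwise RestrictedProduct
open NumberField IsDedekindDomain MeasureTheory Set Filter
open _root_.Topology

namespace Literature.NumberTheory.Automorphic

section Topology

variable (n k : ℕ) (K : Type) [Field K] [NumberField K]

/-- `𝔸_K` is Hausdorff (product of Hausdorff factors; a private copy of `t2Space_adeleRing` of
`QuaternionAlgebraAdelicProofs`, not imported here). [folklore] -/
private theorem t2Space_adeleRing' : T2Space (AdeleRing (𝓞 K) K) := by
  haveI : T2Space (FiniteAdeleRing (𝓞 K) K) := inferInstanceAs <| T2Space
    (Πʳ w : HeightOneSpectrum (𝓞 K), [w.adicCompletion K, w.adicCompletionIntegers K])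
  haveI : T2Space (InfiniteAdeleRing K) :=
    inferInstanceAs <| T2Space ((w : InfinitePlace K) → w.Completion)
  exact inferInstanceAs <| T2Space (InfiniteAdeleRing K × FiniteAdeleRing (𝓞 K) K)

/-- `𝔫_k(𝔸_K)` is closed in `M_n(𝔸_K)` (finitely many closed conditions `X i j = 0`). [folklore] -/
theorem isClosed_blockNilpotent :
    IsClosed (blockNilpotent n k (AdeleRing (𝓞 K) K) : Set (Matrix (Fin n) (Fin n) (AdeleRing (𝓞 K) K))) := by
  haveI := t2Space_adeleRing' K
  have : (blockNilpotent n k (AdeleRing (𝓞 K) K) : Set (Matrix (Fin n) (Fin n) _)) =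
      ⋂ i : Fin n, ⋂ j : Fin n, {M : Matrix (Fin n) (Fin n) (AdeleRing (𝓞 K) K) |
        ¬((i : ℕ) < k ∧ k ≤ (j : ℕ)) → M i j = 0} := by
    ext M
    simp only [SetLike.mem_coe, mem_blockNilpotent_iff, Set.mem_iInter, Set.mem_setOf_eq]
    exact ⟨fun h i j hij => by_contra fun hne => hij (h i j hne),
      fun h i j hne => by_contra fun hij => hne (h i j hij)⟩
  rw [this]
  refine isClosed_iInter fun i => isClosed_iInter fun j => ?_
  by_cases hij : (i : ℕ) < k ∧ k ≤ (j : ℕ)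
  · simp [hij]
  · simp only [hij, not_false_eq_true, forall_const]
    exact isClosed_eq (Continuous.matrix_elem continuous_id i j) continuous_const

/-- `𝔫_k(𝔸_K)` is Hausdorff. [folklore] -/
theorem t2Space_blockNilpotent : T2Space (blockNilpotent n k (AdeleRing (𝓞 K) K)) := by
  haveI := t2Space_adeleRing' K
  infer_instance

/-- **`𝔫_k(𝔸_K)` is locally compact** (a closed subgroup of the locally compact `M_n(𝔸_K)`,
`locallyCompactSpace_matrix_adeleRing`). [folklore] -/
theorem locallyCompactSpace_blockNilpotent :
    LocallyCompactSpace (blockNilpotent n k (AdeleRing (𝓞 K) K)) := by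
  haveI := AdelicGroupData.locallyCompactSpace_matrix_adeleRing K (Fin n)
  exact (isClosed_blockNilpotent n k K).isClosedEmbedding_subtypeVal.locallyCompactSpace

/-- **An additive Haar measure on `𝔫_k(𝔸_K)`** (Mathlib `Measure.addHaar` on the locally compact
group; the Borel structure is `instMeasurableSpaceBlockNilpotent` of `GLnCuspidalSpectrum`).
[folklore] -/
def blockHaar : Measure (blockNilpotent n k (AdeleRing (𝓞 K) K)) :=
  haveI := locallyCompactSpace_blockNilpotent n k K
  Measure.addHaar

/-- `blockHaar` is an additive Haar measure. [folklore] -/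
instance isAddHaarMeasure_blockHaar : (blockHaar n k K).IsAddHaarMeasure := by
  haveI := locallyCompactSpace_blockNilpotent n k K
  unfold blockHaar
  infer_instance

end Topology

/-! ### Entrywise scaling -/

section Scale

variable {n k : ℕ} {K : Type} [Field K] [NumberField K]

/-- **Entrywise multiplication by an adele** `a` on `𝔫_k(𝔸_K)`, an additive endomorphism (the
block condition is preserved). [folklore] -/
def blockScale (a : AdeleRing (𝓞 K) K) :
    blockNilpotent n k (AdeleRing (𝓞 K) K) →+ blockNilpotent n k (AdeleRing (𝓞 K) K) where
  toFun X := ⟨a • (X : Matrix (Fin n) (Fin n) (AdeleRing (𝓞 K) K)), fun i j hij =>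
    X.2 i j fun h0 => hij (by rw [Matrix.smul_apply, h0, smul_zero])⟩
  map_zero' := Subtype.ext (smul_zero a)
  map_add' X Y := Subtype.ext (smul_add a (X : Matrix (Fin n) (Fin n) (AdeleRing (𝓞 K) K)) Y)

/-- The underlying matrix of `blockScale a X` is `a • X`. [folklore] -/
@[simp]
theorem coe_blockScale (a : AdeleRing (𝓞 K) K) (X : blockNilpotent n k (AdeleRing (𝓞 K) K)) :
    ((blockScale a X : blockNilpotent n k (AdeleRing (𝓞 K) K)) :
        Matrix (Fin n) (Fin n) (AdeleRing (𝓞 K) K)) =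
      a • (X : Matrix (Fin n) (Fin n) (AdeleRing (𝓞 K) K)) :=
  rfl

/-- Entries of `blockScale a X` are `a · X i j`. [folklore] -/
theorem blockScale_apply_apply (a : AdeleRing (𝓞 K) K) (X : blockNilpotent n k (AdeleRing (𝓞 K) K))
    (i j : Fin n) :
    ((blockScale a X : blockNilpotent n k (AdeleRing (𝓞 K) K)) :
        Matrix (Fin n) (Fin n) (AdeleRing (𝓞 K) K)) i j =
      a * (X : Matrix (Fin n) (Fin n) (AdeleRing (𝓞 K) K)) i j :=
  rfl

/-- `blockScale` is multiplicative in the scalar. [folklore] -/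
theorem blockScale_blockScale (a b : AdeleRing (𝓞 K) K) (X : blockNilpotent n k (AdeleRing (𝓞 K) K)) :
    blockScale a (blockScale b X) = blockScale (a * b) X :=
  Subtype.ext (smul_smul a b (X : Matrix (Fin n) (Fin n) (AdeleRing (𝓞 K) K)))

/-- `blockScale 1 = id`. [folklore] -/
@[simp]
theorem blockScale_one (X : blockNilpotent n k (AdeleRing (𝓞 K) K)) : blockScale 1 X = X :=
  Subtype.ext (one_smul _ _)

/-- `blockScale a` is continuous. [folklore] -/
theorem continuous_blockScale (a : AdeleRing (𝓞 K) K) :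
    Continuous (blockScale (n := n) (k := k) a) := by
  refine Continuous.subtype_mk ?_ _
  exact continuous_subtype_val.const_smul a

/-- Scaling by `c ∈ K` followed by scaling by `c⁻¹` is the identity (`c ≠ 0`). [folklore] -/
theorem blockScale_algebraMap_inv_blockScale {c : K} (hc : c ≠ 0)
    (X : blockNilpotent n k (AdeleRing (𝓞 K) K)) :
    blockScale (algebraMap K (AdeleRing (𝓞 K) K) c⁻¹) (blockScale (algebraMap K (AdeleRing (𝓞 K) K) c) X) = X := by
  rw [blockScale_blockScale, ← map_mul, inv_mul_cancel₀ hc, map_one, blockScale_one]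

/-- Scaling by `c⁻¹` followed by scaling by `c ∈ Kˣ` is the identity. [folklore] -/
theorem blockScale_algebraMap_blockScale_inv {c : K} (hc : c ≠ 0)
    (X : blockNilpotent n k (AdeleRing (𝓞 K) K)) :
    blockScale (algebraMap K (AdeleRing (𝓞 K) K) c) (blockScale (algebraMap K (AdeleRing (𝓞 K) K) c⁻¹) X) = X := by
  rw [blockScale_blockScale, ← map_mul, mul_inv_cancel₀ hc, map_one, blockScale_one]

/-- **Scaling the lattice**: `γ ↦ c γ` maps `𝔫_k(K)` to itself (`c ∈ K`). [folklore] -/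
theorem blockScale_mem_rationalBlock (c : K) {γ : blockNilpotent n k (AdeleRing (𝓞 K) K)}
    (hγ : γ ∈ rationalBlock n k K) :
    blockScale (algebraMap K (AdeleRing (𝓞 K) K) c) γ ∈ rationalBlock n k K := by
  intro i j
  obtain ⟨r, hr⟩ := hγ i j
  refine ⟨c * r, ?_⟩
  rw [blockScale_apply_apply, map_mul, hr]

/-- Scaling by `c ∈ K` on the lattice `𝔫_k(K)`. [folklore] -/
def ratBlockScale (c : K) (γ : rationalBlock n k K) : rationalBlock n k K :=
  ⟨blockScale (algebraMap K (AdeleRing (𝓞 K) K) c) γ, blockScale_mem_rationalBlock c γ.2⟩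

/-- The underlying element of `ratBlockScale c γ`. [folklore] -/
@[simp]
theorem coe_ratBlockScale (c : K) (γ : rationalBlock n k K) :
    ((ratBlockScale c γ : rationalBlock n k K) : blockNilpotent n k (AdeleRing (𝓞 K) K)) =
      blockScale (algebraMap K (AdeleRing (𝓞 K) K) c) γ :=
  rfl

/-- `ratBlockScale c (ratBlockScale c⁻¹ γ) = γ` for `c ≠ 0`. [folklore] -/
theorem ratBlockScale_ratBlockScale_inv {c : K} (hc : c ≠ 0) (γ : rationalBlock n k K) :
    ratBlockScale c (ratBlockScale c⁻¹ γ) = γ :=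
  Subtype.ext (blockScale_algebraMap_blockScale_inv hc _)

/-- `ratBlockScale c⁻¹ (ratBlockScale c γ) = γ` for `c ≠ 0`. [folklore] -/
theorem ratBlockScale_inv_ratBlockScale {c : K} (hc : c ≠ 0) (γ : rationalBlock n k K) :
    ratBlockScale c⁻¹ (ratBlockScale c γ) = γ :=
  Subtype.ext (blockScale_algebraMap_inv_blockScale hc _)

end Scale

/-! ### Scaled and translated fundamental domains -/

section Domain

variable (n k : ℕ) (K : Type) [Field K] [NumberField K]

/-- **The scaled block fundamental domain `c · 𝓕₀`** (`𝓕₀ = blockFundamentalDomain`, `c ∈ K`): the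
image of Tate's product domain under entrywise multiplication by `c`. For `c ∈ 𝓞 K ∖ 0` its
finite parts are the `c`-multiples of integral finite adeles. [folklore] -/
def scaledBlockFundamentalDomain (c : K) : Set (blockNilpotent n k (AdeleRing (𝓞 K) K)) :=
  blockScale (algebraMap K (AdeleRing (𝓞 K) K) c) '' blockFundamentalDomain n k K

variable {n k K}

/-- Membership in a translate `v + c · 𝓕₀`: `X ∈ v + c · 𝓕₀ ↔ c⁻¹ (X - v) ∈ 𝓕₀` (`c ≠ 0`).
[folklore] -/
theorem mem_vadd_scaledBlockFundamentalDomain_iff {c : K} (hc : c ≠ 0)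
    {v X : blockNilpotent n k (AdeleRing (𝓞 K) K)} :
    X ∈ v +ᵥ scaledBlockFundamentalDomain n k K c ↔
      blockScale (algebraMap K (AdeleRing (𝓞 K) K) c⁻¹) (X - v) ∈ blockFundamentalDomain n k K := by
  rw [Set.mem_vadd_set]
  constructor
  · rintro ⟨_, ⟨X₀, hX₀, rfl⟩, rfl⟩
    rwa [vadd_eq_add, add_sub_cancel_left, blockScale_algebraMap_inv_blockScale hc]
  · intro h
    refine ⟨X - v, ⟨_, h, blockScale_algebraMap_blockScale_inv hc _⟩, ?_⟩
    rw [vadd_eq_add, add_sub_cancel]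

/-- **Exact unique representability modulo `𝔫_k(K)` for the translated scaled domains**: every
`X ∈ 𝔫_k(𝔸_K)` is congruent modulo `𝔫_k(K)` to exactly one point of `v + c · 𝓕₀` (`c ≠ 0`), by
transport of Tate's Thm. 4.1.3 (1) (`existsUnique_vadd_mem_blockFundamentalDomain`) along
`X ↦ c⁻¹ (X - v)` and `γ ↦ c γ`. [cite: CasselsFrohlichANT1967, Ch. XV Thm. 4.1.3 (1)] -/
theorem existsUnique_vadd_mem_vadd_scaledBlockFundamentalDomain {c : K} (hc : c ≠ 0)
    (v X : blockNilpotent n k (AdeleRing (𝓞 K) K)) :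
    ∃! γ : rationalBlock n k K, γ +ᵥ X ∈ v +ᵥ scaledBlockFundamentalDomain n k K c := by
  set Y := blockScale (algebraMap K (AdeleRing (𝓞 K) K) c⁻¹) (X - v) with hY
  -- the condition on `γ` reads: `c⁻¹ γ + Y ∈ 𝓕₀`
  have hiff : ∀ γ : rationalBlock n k K, γ +ᵥ X ∈ v +ᵥ scaledBlockFundamentalDomain n k K c ↔
      ratBlockScale c⁻¹ γ +ᵥ Y ∈ blockFundamentalDomain n k K := by
    intro γ
    rw [mem_vadd_scaledBlockFundamentalDomain_iff hc, AddSubgroup.vadd_def, AddSubgroup.vadd_def,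
      vadd_eq_add, vadd_eq_add, coe_ratBlockScale, hY, ← map_add, add_sub_assoc]
  obtain ⟨γ₀, hγ₀, huniq⟩ := existsUnique_vadd_mem_blockFundamentalDomain n k K Y
  refine ⟨ratBlockScale c γ₀, ?_, fun δ hδ => ?_⟩
  · show ratBlockScale c γ₀ +ᵥ X ∈ v +ᵥ scaledBlockFundamentalDomain n k K c
    rw [hiff, ratBlockScale_inv_ratBlockScale hc]
    exact hγ₀
  · have hδ' : δ +ᵥ X ∈ v +ᵥ scaledBlockFundamentalDomain n k K c := hδ
    rw [hiff] at hδ'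
    have h := huniq _ hδ'
    rw [← h, ratBlockScale_ratBlockScale_inv hc]

/-- The translated scaled domains are Borel sets (preimages of the Borel `𝓕₀` under the continuous
`X ↦ c⁻¹ (X - v)`). [folklore] -/
theorem measurableSet_vadd_scaledBlockFundamentalDomain {c : K} (hc : c ≠ 0)
    (v : blockNilpotent n k (AdeleRing (𝓞 K) K)) :
    MeasurableSet (v +ᵥ scaledBlockFundamentalDomain n k K c) := by
  have heq : v +ᵥ scaledBlockFundamentalDomain n k K c =
      (fun X => blockScale (algebraMap K (AdeleRing (𝓞 K) K) c⁻¹) (X - v)) ⁻¹'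
        blockFundamentalDomain n k K := by
    ext X
    exact mem_vadd_scaledBlockFundamentalDomain_iff hc
  rw [heq]
  exact (measurableSet_blockFundamentalDomain n k K).preimage
    ((continuous_blockScale _).comp (continuous_id.sub continuous_const)).measurable

/-- **The translated scaled block domains are measurable fundamental domains for `𝔫_k(K)` acting on
`𝔫_k(𝔸_K)`**, for every measure (Mathlib `IsAddFundamentalDomain.mk'` from exact unique
representability). In particular `ConstantTermVanishes` can be specialised to every
`v + c · 𝓕₀`. [cite: CasselsFrohlichANT1967, Ch. XV Thm. 4.1.3 (1)] -/
theorem isAddFundamentalDomain_vadd_scaledBlockFundamentalDomain {c : K} (hc : c ≠ 0)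
    (v : blockNilpotent n k (AdeleRing (𝓞 K) K)) (ν : Measure (blockNilpotent n k (AdeleRing (𝓞 K) K))) :
    IsAddFundamentalDomain (rationalBlock n k K) (v +ᵥ scaledBlockFundamentalDomain n k K c) ν :=
  IsAddFundamentalDomain.mk' (measurableSet_vadd_scaledBlockFundamentalDomain hc v).nullMeasurableSet
    (existsUnique_vadd_mem_vadd_scaledBlockFundamentalDomain hc v)

/-- The scaled domain itself is a measurable fundamental domain (the translate by `0`). [folklore] -/
theorem isAddFundamentalDomain_scaledBlockFundamentalDomain {c : K} (hc : c ≠ 0)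
    (ν : Measure (blockNilpotent n k (AdeleRing (𝓞 K) K))) :
    IsAddFundamentalDomain (rationalBlock n k K) (scaledBlockFundamentalDomain n k K c) ν := by
  simpa using isAddFundamentalDomain_vadd_scaledBlockFundamentalDomain hc 0 ν

/-- The scaled domain lies in a compact set: the image of the compact closure of `𝓕₀`. [folklore] -/
theorem exists_isCompact_scaledBlockFundamentalDomain_subset (c : K) :
    ∃ C : Set (blockNilpotent n k (AdeleRing (𝓞 K) K)), IsCompact C ∧ IsClosed C ∧
      scaledBlockFundamentalDomain n k K c ⊆ C := by
  haveI := t2Space_blockNilpotent n k K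
  refine ⟨blockScale (algebraMap K (AdeleRing (𝓞 K) K) c) '' closure (blockFundamentalDomain n k K),
    (isCompact_closure_blockFundamentalDomain n k K).image (continuous_blockScale _), ?_,
    image_mono subset_closure⟩
  exact ((isCompact_closure_blockFundamentalDomain n k K).image (continuous_blockScale _)).isClosed

/-- **The scaled domain is relatively compact.** [folklore] -/
theorem isCompact_closure_scaledBlockFundamentalDomain (c : K) :
    IsCompact (closure (scaledBlockFundamentalDomain n k K c)) := by
  obtain ⟨C, hC, hCcl, hsub⟩ := exists_isCompact_scaledBlockFundamentalDomain_subset (n := n) (k := k) c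
  exact hC.of_isClosed_subset isClosed_closure (closure_minimal hsub hCcl)

/-- Translates of the scaled domain are relatively compact. [folklore] -/
theorem isCompact_closure_vadd_scaledBlockFundamentalDomain (c : K)
    (v : blockNilpotent n k (AdeleRing (𝓞 K) K)) :
    IsCompact (closure (v +ᵥ scaledBlockFundamentalDomain n k K c)) := by
  have h := (isCompact_closure_scaledBlockFundamentalDomain (n := n) (k := k) (K := K) c).image
    (continuous_const.add continuous_id : Continuous fun X : blockNilpotent n k (AdeleRing (𝓞 K) K) => v + X)
  haveI := t2Space_blockNilpotent n k K
  refine h.of_isClosed_subset isClosed_closure (closure_minimal ?_ h.isClosed)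
  rintro _ ⟨X, hX, rfl⟩
  exact ⟨X, subset_closure hX, rfl⟩

/-- The scaled domain has finite measure for every measure finite on compact sets. [folklore] -/
theorem measure_scaledBlockFundamentalDomain_lt_top (c : K)
    (ν : Measure (blockNilpotent n k (AdeleRing (𝓞 K) K))) [IsFiniteMeasureOnCompacts ν] :
    ν (scaledBlockFundamentalDomain n k K c) < ⊤ :=
  (measure_mono subset_closure).trans_lt (isCompact_closure_scaledBlockFundamentalDomain c).measure_lt_top

/-- **The scaled domain has positive Haar measure** (a fundamental domain of the countable group
`𝔫_k(K)` for a non-zero invariant measure; Mathlib `IsAddFundamentalDomain.measure_ne_zero`).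
[folklore] -/
theorem measure_scaledBlockFundamentalDomain_ne_zero {c : K} (hc : c ≠ 0)
    (ν : Measure (blockNilpotent n k (AdeleRing (𝓞 K) K))) [ν.IsAddHaarMeasure] :
    ν (scaledBlockFundamentalDomain n k K c) ≠ 0 := by
  haveI : Countable (rationalBlock n k K) := rationalBlock_countable
  exact (isAddFundamentalDomain_scaledBlockFundamentalDomain hc ν).measure_ne_zero
    (NeZero.ne ν)

/-- **Finite parts of points of `v + c · 𝓕₀`** (`c ∈ 𝓞 K`): the finite component of every entry of
`X - v` is `c · y` with `y` an integral finite adele. [folklore] -/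
theorem snd_apply_of_mem_vadd_scaledBlockFundamentalDomain (c : 𝓞 K)
    {v X : blockNilpotent n k (AdeleRing (𝓞 K) K)}
    (hX : X ∈ v +ᵥ scaledBlockFundamentalDomain n k K (c : K)) (i j : Fin n) :
    ∃ y ∈ integralFiniteAdeles K,
      (((X - v : blockNilpotent n k (AdeleRing (𝓞 K) K)) : Matrix (Fin n) (Fin n) (AdeleRing (𝓞 K) K)) i j).2 =
        algebraMap (𝓞 K) (FiniteAdeleRing (𝓞 K) K) c * y := by
  obtain ⟨_, ⟨X₀, hX₀, rfl⟩, hvX⟩ := Set.mem_vadd_set.1 hX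
  have hsub : X - v = blockScale (algebraMap K (AdeleRing (𝓞 K) K) (c : K)) X₀ := by
    rw [← hvX, vadd_eq_add, add_sub_cancel_left]
  refine ⟨((X₀ : Matrix (Fin n) (Fin n) (AdeleRing (𝓞 K) K)) i j).2, fun w => (hX₀ i j).1 w, ?_⟩
  rw [hsub, blockScale_apply_apply]
  change (algebraMap K (AdeleRing (𝓞 K) K) (c : K)).2 * _ = _
  rw [AdeleRing.algebraMap_snd, ← IsScalarTower.algebraMap_apply]

/-- Archimedean parts of points of `v + c · 𝓕₀` are those of `v + c X₀`, `X₀ ∈ 𝓕₀` (unfolding,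
for use with continuity arguments). [folklore] -/
theorem exists_eq_add_blockScale_of_mem_vadd_scaledBlockFundamentalDomain {c : K}
    {v X : blockNilpotent n k (AdeleRing (𝓞 K) K)}
    (hX : X ∈ v +ᵥ scaledBlockFundamentalDomain n k K c) :
    ∃ X₀ ∈ blockFundamentalDomain n k K, X = v + blockScale (algebraMap K (AdeleRing (𝓞 K) K) c) X₀ := by
  obtain ⟨_, ⟨X₀, hX₀, rfl⟩, hvX⟩ := Set.mem_vadd_set.1 hX
  exact ⟨X₀, hX₀, hvX.symm⟩

end Domain

/-! ### Archimedean and finite parts -/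

section Parts

variable {n k : ℕ} {K : Type} [Field K] [NumberField K]

/-- **The archimedean part** `X_∞ = (X_{ij,∞}, 0)` of `X ∈ 𝔫_k(𝔸_K)`, an additive endomorphism.
[folklore] -/
def blockArchPart : blockNilpotent n k (AdeleRing (𝓞 K) K) →+ blockNilpotent n k (AdeleRing (𝓞 K) K) where
  toFun X :=
    ⟨Matrix.of (fun i j => ((((X : Matrix (Fin n) (Fin n) (AdeleRing (𝓞 K) K)) i j).1,
        (0 : FiniteAdeleRing (𝓞 K) K)) : AdeleRing (𝓞 K) K)),
      fun i j hij => X.2 i j fun h0 => hij (by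
        rw [Matrix.of_apply, h0]; rfl)⟩
  map_zero' := by
    refine Subtype.ext (Matrix.ext fun i j => ?_)
    rfl
  map_add' X Y := by
    refine Subtype.ext (Matrix.ext fun i j => Prod.ext rfl ?_)
    change (0 : FiniteAdeleRing (𝓞 K) K) = 0 + 0
    rw [add_zero]

/-- **The finite part** `X_f = (0, X_{ij,f})` of `X ∈ 𝔫_k(𝔸_K)`, an additive endomorphism.
[folklore] -/
def blockFinPart : blockNilpotent n k (AdeleRing (𝓞 K) K) →+ blockNilpotent n k (AdeleRing (𝓞 K) K) where
  toFun X :=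
    ⟨Matrix.of (fun i j => (((0 : InfiniteAdeleRing K),
        (((X : Matrix (Fin n) (Fin n) (AdeleRing (𝓞 K) K)) i j).2)) : AdeleRing (𝓞 K) K)),
      fun i j hij => X.2 i j fun h0 => hij (by
        rw [Matrix.of_apply, h0]; rfl)⟩
  map_zero' := by
    refine Subtype.ext (Matrix.ext fun i j => ?_)
    rfl
  map_add' X Y := by
    refine Subtype.ext (Matrix.ext fun i j => Prod.ext ?_ rfl)
    change (0 : InfiniteAdeleRing K) = 0 + 0
    rw [add_zero]

/-- Entries of the archimedean part. [folklore] -/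
@[simp]
theorem blockArchPart_apply (X : blockNilpotent n k (AdeleRing (𝓞 K) K)) (i j : Fin n) :
    ((blockArchPart X : blockNilpotent n k (AdeleRing (𝓞 K) K)) : Matrix (Fin n) (Fin n) (AdeleRing (𝓞 K) K)) i j =
      ((((X : Matrix (Fin n) (Fin n) (AdeleRing (𝓞 K) K)) i j).1, 0) : AdeleRing (𝓞 K) K) :=
  rfl

/-- Entries of the finite part. [folklore] -/
@[simp]
theorem blockFinPart_apply (X : blockNilpotent n k (AdeleRing (𝓞 K) K)) (i j : Fin n) :
    ((blockFinPart X : blockNilpotent n k (AdeleRing (𝓞 K) K)) : Matrix (Fin n) (Fin n) (AdeleRing (𝓞 K) K)) i j =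
      (((0 : InfiniteAdeleRing K), (((X : Matrix (Fin n) (Fin n) (AdeleRing (𝓞 K) K)) i j).2)) :
        AdeleRing (𝓞 K) K) :=
  rfl

/-- **`X = X_∞ + X_f`.** [folklore] -/
theorem blockArchPart_add_blockFinPart (X : blockNilpotent n k (AdeleRing (𝓞 K) K)) :
    blockArchPart X + blockFinPart X = X := by
  refine Subtype.ext (Matrix.ext fun i j => Prod.ext ?_ ?_)
  · change (((X : Matrix (Fin n) (Fin n) (AdeleRing (𝓞 K) K)) i j).1) + 0 = _
    rw [add_zero]
  · change 0 + (((X : Matrix (Fin n) (Fin n) (AdeleRing (𝓞 K) K)) i j).2) = _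
    rw [zero_add]

/-- The archimedean part has trivial finite entries. [folklore] -/
theorem snd_blockArchPart_apply (X : blockNilpotent n k (AdeleRing (𝓞 K) K)) (i j : Fin n) :
    (((blockArchPart X : blockNilpotent n k (AdeleRing (𝓞 K) K)) :
      Matrix (Fin n) (Fin n) (AdeleRing (𝓞 K) K)) i j).2 = 0 :=
  rfl

/-- The finite part has trivial archimedean entries. [folklore] -/
theorem fst_blockFinPart_apply (X : blockNilpotent n k (AdeleRing (𝓞 K) K)) (i j : Fin n) :
    (((blockFinPart X : blockNilpotent n k (AdeleRing (𝓞 K) K)) :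
      Matrix (Fin n) (Fin n) (AdeleRing (𝓞 K) K)) i j).1 = 0 :=
  rfl

/-- The finite part keeps the finite entries. [folklore] -/
theorem snd_blockFinPart_apply (X : blockNilpotent n k (AdeleRing (𝓞 K) K)) (i j : Fin n) :
    (((blockFinPart X : blockNilpotent n k (AdeleRing (𝓞 K) K)) :
      Matrix (Fin n) (Fin n) (AdeleRing (𝓞 K) K)) i j).2 =
      ((X : Matrix (Fin n) (Fin n) (AdeleRing (𝓞 K) K)) i j).2 :=
  rfl

/-- The archimedean part keeps the archimedean entries. [folklore] -/
theorem fst_blockArchPart_apply (X : blockNilpotent n k (AdeleRing (𝓞 K) K)) (i j : Fin n) :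
    (((blockArchPart X : blockNilpotent n k (AdeleRing (𝓞 K) K)) :
      Matrix (Fin n) (Fin n) (AdeleRing (𝓞 K) K)) i j).1 =
      ((X : Matrix (Fin n) (Fin n) (AdeleRing (𝓞 K) K)) i j).1 :=
  rfl

/-- The archimedean part is continuous. [folklore] -/
theorem continuous_blockArchPart :
    Continuous (blockArchPart : blockNilpotent n k (AdeleRing (𝓞 K) K) → _) := by
  refine Continuous.subtype_mk ?_ _
  refine continuous_matrix fun i j => ?_
  exact (continuous_fst.comp ((Continuous.matrix_elem continuous_subtype_val i j))).prodMk
    continuous_const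

end Parts

end Literature.NumberTheory.Automorphic
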